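import Summits.Ventures.LatticeQCDFlow.Exactness.FreeFieldHMCZeroMode
import HarnessLib

/-!
# Kennedy–Pendleton's law as a FLOOR for the Metropolis-corrected chain: `τ_int,traj(M) ≥ (1 + cos Nθ)/(2(1 − cos Nθ)) ≥ ξ²/T² − ½`

HONEST FRAMING: exact (Metropolis-corrected) sampling algorithms for lattice gauge theory;
figures of merit are autocorrelation/cost numbers at stated couplings and volumes; no
continuum-physics claim.  (SCALAR calibration rung S0-A: not a gauge result.)

Venture `LatticeQCDFlow` (cell pub-lqcd), topic `Exactness`; FANOUT row 2 (`s0-phi4`, HMC arm: the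
dynamical exponent `z` of the magnetisation).  NEW WORK of the cell over row 2's files
`Phi4HMCPolyObsFloor` (the floor `τ_int ≥ 2Var(f)/⟨(Δf)²⟩_acc − ½` on the polynomial class),
`FreeFieldHMCZeroMode` (the zero mode through the proposal, its exact mean squared jump) and
`Scoring/FreeFieldHMCAutocorrelation` (the acceptance-one skeleton, `τ_int = (1 + c)/(2(1 − c))`
exactly, which listed "the Metropolis-corrected chain's autocorrelations" as NOT CLAIMED).  Nothing is
cited as a fact.  Printed counterparts, NAMED ONLY: Kennedy–Pendleton 1991 (`z = 2` at fixed
trajectory length on the Gaussian model), Caracciolo–Pelissetto–Sokal 1994 (displacement floors).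

Setting: the engine's free field `S = Σ_x [Σ_μ (φ(σ_μ x) − φ_x)² + m² φ_x²]` on `V = n + 1` sites
(`J = shiftCoupling σ m²`, `λ = 0`, `m² > 0`, any shift structure), row 2's EXACT HMC update
`K = hmcOpPhi4 J 0 δ N` (refresh, `N` qpq steps of size `δ`, flip, Metropolis test, else keep), stable
regime `δ²Ω₀² < 4` (`Ω₀² = 2m²`), `θ = arccos(1 − δ²Ω₀²/2)`, `c = cos(Nθ)`, `T = Nδ`; `M = Σ_x φ_x`,
`g = M − ⟨M⟩`, `ρ_g(k) = ∫ g (Kᵏ g) e^{−S} / ∫ g² e^{−S}`.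

* **`hmc_tauInt_ge_of_msd_le_poly_of_coercive`** — the mean-squared-jump floor of
  `Phi4HMCPolyObsFloor` under COERCIVITY `εΣφ² − K ≤ S` in place of `λ > 0` (Gaussian case covered).
* **`free_traj_msd_le`** — the mean squared ACCEPTED jump of `M` per trajectory is at most
  `V(1 − c)/m² · Z_p Z` (`a ≤ 1` on `free_traj_msd_eq`, `β² ≤ 1/Ω₀²`, `(1 − c)² + (1 − c²) = 2(1 − c)`).
* `hmcOpOf_eq_self_of_invariant`, **`free_resonance_frozen`**, **`free_resonance_autocorr`** — AT A
  RESONANCE (`cos Nθ = 1`) THE EXACT CHAIN NEVER MOVES `M`: `Kᵏ F(M) = F(M)` and `ρ_g(k) = 1` for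
  every `k` — the corrected chain inherits the skeleton's resonances verbatim.
* **`freeHMC_traj_tauInt_ge_magnetisation`** — THE THEOREM: every `m² > 0`, `δ > 0` with
  `δ²·2m² < 4`, every `N`, volume, shift structure; summable autocorrelations with `ρ_g(1) < 1` ⇒
  `τ_int,traj(M) ≥ (1 + cos Nθ)/(2(1 − cos Nθ))` — EXACTLY the skeleton's `τ_int`
  (`Scoring.unadjusted_tauInt`): in the `τ_int` sense the accept/reject step can only SLOW the zero
  mode relative to the free rotation, at every step size.
* **`freeHMC_traj_tauInt_ge_corrLength`** — hence `τ_int,traj(M) ≥ 1/(m² T²) − ½ = ξ²/T² − ½`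
  (`1 − cos Nθ ≤ T² m²`): **`z ≥ 2` AT FIXED TRAJECTORY LENGTH FOR THE METROPOLIS-CORRECTED
  ALGORITHM**, not only for its skeleton; **`freeHMC_oneStep_tauInt_ge`** — `N = 1`:
  `τ_int(M) ≥ 1/(δ² m²) − ½`, which IS the one-step floor `2χ/δ² − ½` of `Phi4HMCPolyObsFloor` at
  `χ = 1/(2m²)` (the two routes agree).

Reading for S0-A (no numerics implied): on the HMC arm the free-field magnetisation costs at least
`ξ²/T²` trajectories per independent value whatever the acceptance; `T ∝ ξ` makes the floor `O(1)`
(the `z = 1` tuning) at the price of the resonances, inherited unchanged.  NOT CLAIMED: `ρ_g(1) < 1` /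
summability for any run (hypotheses); `λ > 0` (there `Phi4HMCPolyObsFloor` holds modulo the momentum
profile); upper bounds on `τ_int`; the other modes.
-/

namespace Summit.Ventures.LatticeQCDFlow.Exactness

open Real MeasureTheory Filter Finset
open Summit.Ventures.LatticeQCDFlow.Scoring

/-! ## §1 The mean-squared-jump floor on `PolyObs` under coercivity -/
section Coercive

variable {n : ℕ}

/-- **THE MEAN-SQUARED-JUMP FLOOR ON `PolyObs`, COERCIVE FORM** (`εΣφ² − K ≤ S`, `ε > 0`, any real
`λ`, `J`; else verbatim `Phi4HMCPolyObsFloor.hmc_tauInt_ge_of_msd_le_poly`): `f ∈ PolyObs` with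
`∫∫ a (f((Ψ z).1) − f(z.1))² e^{−H} ≤ D Z_p Z`, summable autocorrelations of `g = f − ⟨f⟩`,
`ρ_g(1) < 1` ⇒ `τ_int(f) ≥ 2⟨(f − ⟨f⟩)²⟩/D − ½`. -/
theorem hmc_tauInt_ge_of_msd_le_poly_of_coercive {J : Fin (n + 1) → Fin (n + 1) → ℝ} {lam ε K : ℝ}
    (hε : 0 < ε) (hS : ∀ φ : Fin (n + 1) → ℝ, ε * ∑ w, φ w ^ 2 - K ≤ latticePhi4Action J lam φ)
    {Ψ : (Fin (n + 1) → ℝ) × (Fin (n + 1) → ℝ) → (Fin (n + 1) → ℝ) × (Fin (n + 1) → ℝ)}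
    (hΨm : Measurable Ψ) (hΨi : Function.Involutive Ψ)
    (hΨμ : MeasurePreserving Ψ ((volume : Measure (Fin (n + 1) → ℝ)).prod volume)
      ((volume : Measure (Fin (n + 1) → ℝ)).prod volume))
    {C : ℝ} {m : ℕ} (hC : 0 ≤ C) (hΨg : ∀ z, phaseSize (Ψ z) ≤ C * phaseSize z ^ m)
    {f : (Fin (n + 1) → ℝ) → ℝ} (hf : PolyObs f) {D : ℝ}
    (hD : ∫ z, involAccept (phi4HmcEnergy J lam) Ψ z * (f (Ψ z).1 - f z.1) ^ 2
        * Real.exp (-phi4HmcEnergy J lam z) ∂((volume : Measure (Fin (n + 1) → ℝ)).prod volume)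
        ≤ D * (momentumZ n * gibbsZ J lam))
    (hs : Summable fun k => (∫ φ, (f φ - gibbsExpect J lam f)
        * ((hmcOpOf J lam Ψ)^[k + 1] (fun ψ => f ψ - gibbsExpect J lam f)) φ * gibbsWeight J lam φ)
        / ∫ φ, (f φ - gibbsExpect J lam f) ^ 2 * gibbsWeight J lam φ)
    (hρ : (∫ φ, (f φ - gibbsExpect J lam f)
        * hmcOpOf J lam Ψ (fun ψ => f ψ - gibbsExpect J lam f) φ * gibbsWeight J lam φ)
        / (∫ φ, (f φ - gibbsExpect J lam f) ^ 2 * gibbsWeight J lam φ) < 1) :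
    2 * gibbsExpect J lam (fun φ => (f φ - gibbsExpect J lam f) ^ 2) / D - 1 / 2
      ≤ tauInt (fun k => (∫ φ, (f φ - gibbsExpect J lam f)
          * ((hmcOpOf J lam Ψ)^[k] (fun ψ => f ψ - gibbsExpect J lam f)) φ * gibbsWeight J lam φ)
          / ∫ φ, (f φ - gibbsExpect J lam f) ^ 2 * gibbsWeight J lam φ) := by
  have hZ := gibbsZ_pos_of_coercive hε hS
  have hZp := momentumZ_pos n
  have hg : PolyObs (fun ψ => f ψ - gibbsExpect J lam f) := polyObs_sub_const hf _
  have hΓ : ∫ φ, hmcOpOf J lam Ψ (fun ψ => ((f ψ - gibbsExpect J lam f)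
      - (f φ - gibbsExpect J lam f)) ^ 2) φ * gibbsWeight J lam φ ≤ D * gibbsZ J lam := by
    rw [integral_hmcOpOf_sq_dev_eq_poly hε hS hΨm hΨμ hg]
    have e : ∀ z : (Fin (n + 1) → ℝ) × (Fin (n + 1) → ℝ),
        involAccept (phi4HmcEnergy J lam) Ψ z * ((f (Ψ z).1 - gibbsExpect J lam f)
          - (f z.1 - gibbsExpect J lam f)) ^ 2 * Real.exp (-phi4HmcEnergy J lam z)
        = involAccept (phi4HmcEnergy J lam) Ψ z * (f (Ψ z).1 - f z.1) ^ 2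
          * Real.exp (-phi4HmcEnergy J lam z) := fun z => by ring
    simp_rw [e]
    rw [div_le_iff₀ hZp]
    calc _ ≤ D * (momentumZ n * gibbsZ J lam) := hD
      _ = D * gibbsZ J lam * momentumZ n := by ring
  have hfloor := RevOp.tauInt_ge_of_integral_carre_le (μ := volume) (A := PolyObs)
    (K := hmcOpOf J lam Ψ) (w := gibbsWeight J lam)
    (fun φ => (gibbsWeight_pos J lam φ).le) (polyObs_const 1)
    (fun f h hf hh => polyObs_integrable_mul_mul_gibbsWeight hε hS hf hh)
    (fun f h c hf hh => polyObs_add_mul hf hh c)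
    (fun f hf => polyObs_hmcOpOf J lam hΨm hC hΨg hf)
    (fun f h c hf hh x => hmcOpOf_add_mul_poly J lam hΨm hC hΨg hf hh c x)
    (fun f h hf hh => hmc_reversible_poly hε hS hΨm hΨi hΨμ hf hh)
    (fun f hf => hmcOpOf_contraction_poly hε hS hΨm hΨi hΨμ hC hΨg hf)
    (fun φ => hmcOpOf_one J lam Ψ φ) hg (polyObs_sq hg) hΓ hs hρ
  have e : ∀ P : ℝ, 2 * (P / gibbsZ J lam) / D - 1 / 2 = 2 * P / (D * gibbsZ J lam) - 1 / 2 := by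
    intro P
    rw [mul_div_assoc, div_div, mul_comm (gibbsZ J lam) D, ← mul_div_assoc]
  unfold gibbsExpect
  exact (e _).le.trans hfloor

/-- An observable INVARIANT under the proposal from `φ` (`f((Ψ(φ,p)).1) = f(φ)` for all `p`) is fixed
by the HMC-type update at `φ`: `(K_Ψ f)(φ) = f(φ)` — accept or reject. -/
theorem hmcOpOf_eq_self_of_invariant (J : Fin (n + 1) → Fin (n + 1) → ℝ) (lam : ℝ)
    (Ψ : (Fin (n + 1) → ℝ) × (Fin (n + 1) → ℝ) → (Fin (n + 1) → ℝ) × (Fin (n + 1) → ℝ))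
    {f : (Fin (n + 1) → ℝ) → ℝ} {φ : Fin (n + 1) → ℝ} (h : ∀ p, f (Ψ (φ, p)).1 = f φ) :
    hmcOpOf J lam Ψ f φ = f φ := by
  unfold hmcOpOf
  have e : ∀ p : Fin (n + 1) → ℝ,
      (involAccept (phi4HmcEnergy J lam) Ψ (φ, p) * f (Ψ (φ, p)).1
        + (1 - involAccept (phi4HmcEnergy J lam) Ψ (φ, p)) * f φ) * momentumWeight p
      = f φ * momentumWeight p := fun p => by rw [h p]; ring
  simp_rw [e]
  rw [integral_const_mul]
  exact mul_div_cancel_right₀ (f φ) (momentumZ_pos n).ne'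

end Coercive

/-! ## §2 The free field: the accepted jump, resonances, and the floor -/
section Free

variable {n : ℕ} {ι : Type*} [Fintype ι]

/-- **THE MEAN SQUARED ACCEPTED JUMP OF THE ZERO MODE IS AT MOST `V(1 − cos Nθ)/m²`** (units
`Z_p Z`; free field, `m² > 0`, stable regime, every `N`): `∫∫ a (M((Ψ z).1) − M(z.1))² e^{−H} ≤
((n+1)(1 − c)/m²) Z_p Z` (`a ≤ 1`, `(1 − c)² + (1 − c²) = 2(1 − c)`, `β² ≤ 1/Ω₀²`). -/
theorem free_traj_msd_le (σ : ι → Equiv.Perm (Fin (n + 1))) {m2 δ : ℝ} (hδ : 0 < δ)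
    (hm : 0 < m2) (hst : δ ^ 2 * (2 * m2) < 4) (N : ℕ) :
    ∫ z : (Fin (n + 1) → ℝ) × (Fin (n + 1) → ℝ),
        involAccept (phi4HmcEnergy (shiftCoupling σ m2) 0) (hmcProposal (shiftCoupling σ m2) 0 δ N) z
          * ((∑ x, (hmcProposal (shiftCoupling σ m2) 0 δ N z).1 x) - ∑ x, z.1 x) ^ 2
          * Real.exp (-phi4HmcEnergy (shiftCoupling σ m2) 0 z)
        ∂((volume : Measure (Fin (n + 1) → ℝ)).prod volume)
      ≤ ((n : ℝ) + 1) * (1 - Real.cos (N * Real.arccos (1 - δ ^ 2 * (2 * m2) / 2))) / m2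
          * (momentumZ n * gibbsZ (shiftCoupling σ m2) 0) := by
  set J := shiftCoupling σ m2 with hJ
  set θ := Real.arccos (1 - δ ^ 2 * (2 * m2) / 2) with hθ
  set H := phi4HmcEnergy J 0 with hH
  set Ψ := hmcProposal J 0 δ N with hΨ
  have hZ := gibbsZ_pos_of_coercive hm (free_coercive σ m2)
  have hZp := momentumZ_pos n
  have hV : (0 : ℝ) < (n : ℝ) + 1 := by positivity
  -- `a ≤ 1`: pass to the unaccepted majorant, whose integral is known in closed form
  have hmono : ∫ z, involAccept H Ψ z * ((∑ x, (Ψ z).1 x) - ∑ x, z.1 x) ^ 2 * Real.exp (-H z)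
        ∂((volume : Measure (Fin (n + 1) → ℝ)).prod volume)
      ≤ ∫ z, ((∑ x, (Ψ z).1 x) - ∑ x, z.1 x) ^ 2 * Real.exp (-H z)
        ∂((volume : Measure (Fin (n + 1) → ℝ)).prod volume) := by
    refine integral_mono_of_nonneg (Eventually.of_forall fun z => ?_)
      (free_integrable_traj_msd σ hδ hm hst N) (Eventually.of_forall fun z => ?_)
    · exact mul_nonneg (mul_nonneg (involAccept_nonneg H Ψ z) (sq_nonneg _)) (Real.exp_pos _).le
    · have h1 := involAccept_le_one H Ψ z
      have h0 : 0 ≤ ((∑ x, (Ψ z).1 x) - ∑ x, z.1 x) ^ 2 * Real.exp (-H z) :=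
        mul_nonneg (sq_nonneg _) (Real.exp_pos _).le
      calc involAccept H Ψ z * ((∑ x, (Ψ z).1 x) - ∑ x, z.1 x) ^ 2 * Real.exp (-H z)
          = involAccept H Ψ z * (((∑ x, (Ψ z).1 x) - ∑ x, z.1 x) ^ 2 * Real.exp (-H z)) := by ring
        _ ≤ 1 * (((∑ x, (Ψ z).1 x) - ∑ x, z.1 x) ^ 2 * Real.exp (-H z)) :=
          mul_le_mul_of_nonneg_right h1 h0
        _ = ((∑ x, (Ψ z).1 x) - ∑ x, z.1 x) ^ 2 * Real.exp (-H z) := one_mul _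
  refine hmono.trans ?_
  rw [hΨ, hH, hJ, free_traj_msd_eq σ hδ hm hst N]
  -- the closed form is at most `V(1 − c)/m²`
  set c := Real.cos (N * θ) with hc
  set s := Real.sin (N * θ) with hs
  set β := δ * (1 - δ ^ 2 * (2 * m2) / 4) / Real.sin θ with hβ
  have hβ2 : β ^ 2 ≤ 1 / (2 * m2) := rotation_beta_sq_le hδ (by positivity) hst
  have hs2 : s ^ 2 = 1 - c ^ 2 := by rw [hs, hc, Real.sin_sq]
  have hc1 : c ≤ 1 := Real.cos_le_one _
  have hkey : (1 - c) ^ 2 * (((n : ℝ) + 1) / (2 * m2)) + (β * s) ^ 2 * ((n : ℝ) + 1)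
      ≤ ((n : ℝ) + 1) * (1 - c) / m2 := by
    have h1 : (β * s) ^ 2 ≤ (1 - c ^ 2) / (2 * m2) := by
      rw [mul_pow, ← hs2]
      calc β ^ 2 * s ^ 2 ≤ 1 / (2 * m2) * s ^ 2 := mul_le_mul_of_nonneg_right hβ2 (sq_nonneg _)
        _ = s ^ 2 / (2 * m2) := by ring
    have e : ((n : ℝ) + 1) * (1 - c) / m2
        = (1 - c) ^ 2 * (((n : ℝ) + 1) / (2 * m2)) + (1 - c ^ 2) / (2 * m2) * ((n : ℝ) + 1) := by
      field_simp
      ring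
    rw [e]
    exact add_le_add le_rfl (mul_le_mul_of_nonneg_right h1 hV.le)
  calc ((1 - c) ^ 2 * (((n : ℝ) + 1) / (2 * m2)) + (β * s) ^ 2 * ((n : ℝ) + 1))
        * (gibbsZ J 0 * momentumZ n)
      ≤ ((n : ℝ) + 1) * (1 - c) / m2 * (gibbsZ J 0 * momentumZ n) :=
        mul_le_mul_of_nonneg_right hkey (mul_pos hZ hZp).le
    _ = ((n : ℝ) + 1) * (1 - c) / m2 * (momentumZ n * gibbsZ J 0) := by ring

/-- **AT A RESONANCE THE EXACT CHAIN NEVER MOVES THE MAGNETISATION.**  Free field, `m² > 0`, stable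
regime; if `cos(Nθ) = 1` then for every function `F(M)` of the magnetisation and every `k`, `φ`:
`(Kᵏ F(M))(φ) = F(M(φ))` — the proposal returns `M` exactly (`sin Nθ = 0`), and rejection keeps it. -/
theorem free_resonance_frozen (σ : ι → Equiv.Perm (Fin (n + 1))) {m2 δ : ℝ} (hδ : 0 < δ)
    (hm : 0 < m2) (hst : δ ^ 2 * (2 * m2) < 4) {N : ℕ}
    (hc : Real.cos (N * Real.arccos (1 - δ ^ 2 * (2 * m2) / 2)) = 1) (F : ℝ → ℝ) (k : ℕ)
    (φ : Fin (n + 1) → ℝ) :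
    ((hmcOpPhi4 (shiftCoupling σ m2) 0 δ N)^[k] (fun ψ => F (∑ x, ψ x))) φ = F (∑ x, φ x) := by
  have hsin : Real.sin (N * Real.arccos (1 - δ ^ 2 * (2 * m2) / 2)) = 0 := by
    have h := Real.sin_sq_add_cos_sq (N * Real.arccos (1 - δ ^ 2 * (2 * m2) / 2))
    rw [hc, one_pow] at h
    exact pow_eq_zero_iff (two_ne_zero) |>.mp (by linarith)
  have hinv : ∀ z : (Fin (n + 1) → ℝ) × (Fin (n + 1) → ℝ),
      ∑ x, (hmcProposal (shiftCoupling σ m2) 0 δ N z).1 x = ∑ x, z.1 x := by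
    intro z
    rw [free_totalField_hmcProposal σ hδ hm hst N z, hc, hsin]
    ring
  have hfix : ∀ ψ : Fin (n + 1) → ℝ,
      hmcOpPhi4 (shiftCoupling σ m2) 0 δ N (fun ψ => F (∑ x, ψ x)) ψ = F (∑ x, ψ x) := by
    intro ψ
    unfold hmcOpPhi4
    exact hmcOpOf_eq_self_of_invariant _ _ _ (fun p => by rw [hinv (ψ, p)])
  have hfun : hmcOpPhi4 (shiftCoupling σ m2) 0 δ N (fun ψ => F (∑ x, ψ x))
      = fun ψ => F (∑ x, ψ x) := funext hfix
  induction k with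
  | zero => rfl
  | succ k ih =>
      rw [Function.iterate_succ_apply, hfun]
      exact ih

/-- **Hence at a resonance every autocorrelation of the magnetisation is `1`**: `ρ_g(k) = 1`. -/
theorem free_resonance_autocorr (σ : ι → Equiv.Perm (Fin (n + 1))) {m2 δ : ℝ} (hδ : 0 < δ)
    (hm : 0 < m2) (hst : δ ^ 2 * (2 * m2) < 4) {N : ℕ}
    (hc : Real.cos (N * Real.arccos (1 - δ ^ 2 * (2 * m2) / 2)) = 1) (k : ℕ) :
    (∫ φ, ((∑ x, φ x) - gibbsExpect (shiftCoupling σ m2) 0 (fun ψ => ∑ x, ψ x))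
        * ((hmcOpPhi4 (shiftCoupling σ m2) 0 δ N)^[k]
            (fun ψ => (∑ x, ψ x) - gibbsExpect (shiftCoupling σ m2) 0 (fun ψ => ∑ x, ψ x))) φ
        * gibbsWeight (shiftCoupling σ m2) 0 φ)
      / (∫ φ, ((∑ x, φ x) - gibbsExpect (shiftCoupling σ m2) 0 (fun ψ => ∑ x, ψ x)) ^ 2
        * gibbsWeight (shiftCoupling σ m2) 0 φ) = 1 := by
  have hZ := gibbsZ_pos_of_coercive hm (free_coercive σ m2)
  rw [free_totalField_mean σ hm]
  simp only [sub_zero]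
  have hk : ∀ φ : Fin (n + 1) → ℝ,
      ((hmcOpPhi4 (shiftCoupling σ m2) 0 δ N)^[k] (fun ψ => ∑ x, ψ x)) φ = ∑ x, φ x :=
    fun φ => free_resonance_frozen σ hδ hm hst hc (fun t => t) k φ
  simp_rw [hk]
  have hpos : 0 < ∫ φ : Fin (n + 1) → ℝ, (∑ x, φ x) ^ 2 * gibbsWeight (shiftCoupling σ m2) 0 φ := by
    rw [free_integral_totalField_sq σ hm]
    exact mul_pos (by positivity) hZ
  rw [div_eq_one_iff_eq hpos.ne']
  exact integral_congr_ae (Eventually.of_forall fun φ => by dsimp only; ring)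

/-- **KENNEDY–PENDLETON'S LAW AS A FLOOR FOR THE METROPOLIS-CORRECTED CHAIN.**  Free field, every
`m² > 0`, `δ > 0` with `δ²·2m² < 4`, every `N`, every volume and shift structure; `g = M − ⟨M⟩`
with summable autocorrelations and `ρ_g(1) < 1` under the EXACT HMC update `hmcOpPhi4 J 0 δ N`.
Then `τ_int,traj(M) ≥ (1 + cos Nθ)/(2(1 − cos Nθ))`, `θ = arccos(1 − δ²m²·(2/2))` — the
acceptance-one skeleton's exact value (`Scoring.unadjusted_tauInt`). -/
theorem freeHMC_traj_tauInt_ge_magnetisation (σ : ι → Equiv.Perm (Fin (n + 1))) {m2 δ : ℝ}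
    (hδ : 0 < δ) (hm : 0 < m2) (hst : δ ^ 2 * (2 * m2) < 4) (N : ℕ)
    (hs : Summable fun k => (∫ φ, ((∑ x, φ x) - gibbsExpect (shiftCoupling σ m2) 0 (fun ψ => ∑ x, ψ x))
        * ((hmcOpPhi4 (shiftCoupling σ m2) 0 δ N)^[k + 1]
            (fun ψ => (∑ x, ψ x) - gibbsExpect (shiftCoupling σ m2) 0 (fun ψ => ∑ x, ψ x))) φ
        * gibbsWeight (shiftCoupling σ m2) 0 φ)
        / ∫ φ, ((∑ x, φ x) - gibbsExpect (shiftCoupling σ m2) 0 (fun ψ => ∑ x, ψ x)) ^ 2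
          * gibbsWeight (shiftCoupling σ m2) 0 φ)
    (hρ : (∫ φ, ((∑ x, φ x) - gibbsExpect (shiftCoupling σ m2) 0 (fun ψ => ∑ x, ψ x))
        * hmcOpPhi4 (shiftCoupling σ m2) 0 δ N
            (fun ψ => (∑ x, ψ x) - gibbsExpect (shiftCoupling σ m2) 0 (fun ψ => ∑ x, ψ x)) φ
        * gibbsWeight (shiftCoupling σ m2) 0 φ)
        / (∫ φ, ((∑ x, φ x) - gibbsExpect (shiftCoupling σ m2) 0 (fun ψ => ∑ x, ψ x)) ^ 2
          * gibbsWeight (shiftCoupling σ m2) 0 φ) < 1) :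
    (1 + Real.cos (N * Real.arccos (1 - δ ^ 2 * (2 * m2) / 2)))
        / (2 * (1 - Real.cos (N * Real.arccos (1 - δ ^ 2 * (2 * m2) / 2))))
      ≤ tauInt (fun k => (∫ φ, ((∑ x, φ x) - gibbsExpect (shiftCoupling σ m2) 0 (fun ψ => ∑ x, ψ x))
        * ((hmcOpPhi4 (shiftCoupling σ m2) 0 δ N)^[k]
            (fun ψ => (∑ x, ψ x) - gibbsExpect (shiftCoupling σ m2) 0 (fun ψ => ∑ x, ψ x))) φ
        * gibbsWeight (shiftCoupling σ m2) 0 φ)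
        / ∫ φ, ((∑ x, φ x) - gibbsExpect (shiftCoupling σ m2) 0 (fun ψ => ∑ x, ψ x)) ^ 2
          * gibbsWeight (shiftCoupling σ m2) 0 φ) := by
  set c := Real.cos (N * Real.arccos (1 - δ ^ 2 * (2 * m2) / 2)) with hc_def
  -- not at a resonance (else `ρ_g(1) = 1`)
  have hc : c ≠ 1 := by
    intro h1
    have h := free_resonance_autocorr σ hδ hm hst h1 1
    simp only [Function.iterate_one] at h
    rw [h] at hρ
    exact lt_irrefl _ hρ
  have h1c : 0 < 1 - c := sub_pos.mpr (lt_of_le_of_ne (Real.cos_le_one _) hc)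
  have hco := free_coercive σ m2
  obtain ⟨C, hC1, hCg⟩ := hmcProposal_growth (shiftCoupling σ m2) 0 δ N
  have hD := free_traj_msd_le σ hδ hm hst N
  have h := hmc_tauInt_ge_of_msd_le_poly_of_coercive hm hco
    (measurable_hmcProposal (shiftCoupling σ m2) 0 δ N)
    (hmcProposal_involutive (shiftCoupling σ m2) 0 δ N)
    (measurePreserving_hmcProposal (shiftCoupling σ m2) 0 δ N)
    (zero_le_one.trans hC1) hCg polyObs_magnetisation hD hs hρ
  have hvar : gibbsExpect (shiftCoupling σ m2) 0 (fun φ =>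
      ((∑ x, φ x) - gibbsExpect (shiftCoupling σ m2) 0 (fun ψ => ∑ x, ψ x)) ^ 2)
      = ((n : ℝ) + 1) / (2 * m2) := by
    simp only [free_totalField_mean σ hm, sub_zero]
    exact free_totalField_sq σ hm
  rw [hvar] at h
  have hV : (0 : ℝ) < (n : ℝ) + 1 := by positivity
  have e : 2 * (((n : ℝ) + 1) / (2 * m2)) / (((n : ℝ) + 1) * (1 - c) / m2) - 1 / 2
      = (1 + c) / (2 * (1 - c)) := by
    field_simp
    ring
  rw [e] at h
  exact h

/-- **`z ≥ 2` AT FIXED TRAJECTORY LENGTH, FOR THE EXACT ALGORITHM**: under the same hypotheses,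
`τ_int,traj(M) ≥ 1/(m² (Nδ)²) − ½` (`= ξ²/T² − ½`, `ξ² = 1/m²`, `T = Nδ`;
`1 − cos Nθ ≤ N²(1 − cos θ) = T² m²`, `Scoring.one_sub_cos_traj_le`). -/
theorem freeHMC_traj_tauInt_ge_corrLength (σ : ι → Equiv.Perm (Fin (n + 1))) {m2 δ : ℝ}
    (hδ : 0 < δ) (hm : 0 < m2) (hst : δ ^ 2 * (2 * m2) < 4) (N : ℕ)
    (hs : Summable fun k => (∫ φ, ((∑ x, φ x) - gibbsExpect (shiftCoupling σ m2) 0 (fun ψ => ∑ x, ψ x))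
        * ((hmcOpPhi4 (shiftCoupling σ m2) 0 δ N)^[k + 1]
            (fun ψ => (∑ x, ψ x) - gibbsExpect (shiftCoupling σ m2) 0 (fun ψ => ∑ x, ψ x))) φ
        * gibbsWeight (shiftCoupling σ m2) 0 φ)
        / ∫ φ, ((∑ x, φ x) - gibbsExpect (shiftCoupling σ m2) 0 (fun ψ => ∑ x, ψ x)) ^ 2
          * gibbsWeight (shiftCoupling σ m2) 0 φ)
    (hρ : (∫ φ, ((∑ x, φ x) - gibbsExpect (shiftCoupling σ m2) 0 (fun ψ => ∑ x, ψ x))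
        * hmcOpPhi4 (shiftCoupling σ m2) 0 δ N
            (fun ψ => (∑ x, ψ x) - gibbsExpect (shiftCoupling σ m2) 0 (fun ψ => ∑ x, ψ x)) φ
        * gibbsWeight (shiftCoupling σ m2) 0 φ)
        / (∫ φ, ((∑ x, φ x) - gibbsExpect (shiftCoupling σ m2) 0 (fun ψ => ∑ x, ψ x)) ^ 2
          * gibbsWeight (shiftCoupling σ m2) 0 φ) < 1) :
    1 / (m2 * ((N : ℝ) * δ) ^ 2) - 1 / 2
      ≤ tauInt (fun k => (∫ φ, ((∑ x, φ x) - gibbsExpect (shiftCoupling σ m2) 0 (fun ψ => ∑ x, ψ x))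
        * ((hmcOpPhi4 (shiftCoupling σ m2) 0 δ N)^[k]
            (fun ψ => (∑ x, ψ x) - gibbsExpect (shiftCoupling σ m2) 0 (fun ψ => ∑ x, ψ x))) φ
        * gibbsWeight (shiftCoupling σ m2) 0 φ)
        / ∫ φ, ((∑ x, φ x) - gibbsExpect (shiftCoupling σ m2) 0 (fun ψ => ∑ x, ψ x)) ^ 2
          * gibbsWeight (shiftCoupling σ m2) 0 φ) := by
  set c := Real.cos (N * Real.arccos (1 - δ ^ 2 * (2 * m2) / 2)) with hc_def
  have hmain := freeHMC_traj_tauInt_ge_magnetisation σ hδ hm hst N hs hρ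
  have hc : c ≠ 1 := by
    intro h1
    have h := free_resonance_autocorr σ hδ hm hst h1 1
    simp only [Function.iterate_one] at h
    rw [h] at hρ
    exact lt_irrefl _ hρ
  have h1c : 0 < 1 - c := sub_pos.mpr (lt_of_le_of_ne (Real.cos_le_one _) hc)
  refine le_trans ?_ hmain
  -- `1 − c ≤ (Nδ)² m²`
  have hle : 1 - c ≤ ((N : ℝ) * δ) ^ 2 * m2 := by
    have h := one_sub_cos_traj_le (δ := δ) (w2 := 2 * m2) (by positivity) hst N
    calc 1 - c ≤ ((N : ℝ) * δ) ^ 2 * (2 * m2) / 2 := h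
      _ = ((N : ℝ) * δ) ^ 2 * m2 := by ring
  have hT : 0 < m2 * ((N : ℝ) * δ) ^ 2 := by
    have : 0 < ((N : ℝ) * δ) ^ 2 * m2 := lt_of_lt_of_le h1c hle
    linarith [this]
  have e : (1 + c) / (2 * (1 - c)) = 1 / (1 - c) - 1 / 2 := by
    field_simp
    ring
  rw [e]
  refine sub_le_sub_right ?_ _
  exact one_div_le_one_div_of_le h1c (by linarith)

/-- **The one-step corner (`N = 1`)**: `τ_int(M) ≥ 1/(δ² m²) − ½` — the one-step floor `2χ/δ² − ½`
of `Phi4HMCPolyObsFloor.hmcPhi4_oneStep_tauInt_ge_magnetisation` at `χ = 1/(2m²)`. -/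
theorem freeHMC_oneStep_tauInt_ge (σ : ι → Equiv.Perm (Fin (n + 1))) {m2 δ : ℝ}
    (hδ : 0 < δ) (hm : 0 < m2) (hst : δ ^ 2 * (2 * m2) < 4)
    (hs : Summable fun k => (∫ φ, ((∑ x, φ x) - gibbsExpect (shiftCoupling σ m2) 0 (fun ψ => ∑ x, ψ x))
        * ((hmcOpPhi4 (shiftCoupling σ m2) 0 δ 1)^[k + 1]
            (fun ψ => (∑ x, ψ x) - gibbsExpect (shiftCoupling σ m2) 0 (fun ψ => ∑ x, ψ x))) φ
        * gibbsWeight (shiftCoupling σ m2) 0 φ)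
        / ∫ φ, ((∑ x, φ x) - gibbsExpect (shiftCoupling σ m2) 0 (fun ψ => ∑ x, ψ x)) ^ 2
          * gibbsWeight (shiftCoupling σ m2) 0 φ)
    (hρ : (∫ φ, ((∑ x, φ x) - gibbsExpect (shiftCoupling σ m2) 0 (fun ψ => ∑ x, ψ x))
        * hmcOpPhi4 (shiftCoupling σ m2) 0 δ 1
            (fun ψ => (∑ x, ψ x) - gibbsExpect (shiftCoupling σ m2) 0 (fun ψ => ∑ x, ψ x)) φ
        * gibbsWeight (shiftCoupling σ m2) 0 φ)
        / (∫ φ, ((∑ x, φ x) - gibbsExpect (shiftCoupling σ m2) 0 (fun ψ => ∑ x, ψ x)) ^ 2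
          * gibbsWeight (shiftCoupling σ m2) 0 φ) < 1) :
    1 / (δ ^ 2 * m2) - 1 / 2
      ≤ tauInt (fun k => (∫ φ, ((∑ x, φ x) - gibbsExpect (shiftCoupling σ m2) 0 (fun ψ => ∑ x, ψ x))
        * ((hmcOpPhi4 (shiftCoupling σ m2) 0 δ 1)^[k]
            (fun ψ => (∑ x, ψ x) - gibbsExpect (shiftCoupling σ m2) 0 (fun ψ => ∑ x, ψ x))) φ
        * gibbsWeight (shiftCoupling σ m2) 0 φ)
        / ∫ φ, ((∑ x, φ x) - gibbsExpect (shiftCoupling σ m2) 0 (fun ψ => ∑ x, ψ x)) ^ 2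
          * gibbsWeight (shiftCoupling σ m2) 0 φ) := by
  have h := freeHMC_traj_tauInt_ge_magnetisation σ hδ hm hst 1 hs hρ
  have ha1 : -1 ≤ 1 - δ ^ 2 * (2 * m2) / 2 := by nlinarith [sq_nonneg δ]
  have ha2 : 1 - δ ^ 2 * (2 * m2) / 2 ≤ 1 := by nlinarith [sq_nonneg δ]
  have hcos : Real.cos ((1 : ℕ) * Real.arccos (1 - δ ^ 2 * (2 * m2) / 2)) = 1 - δ ^ 2 * m2 := by
    rw [Nat.cast_one, one_mul, Real.cos_arccos ha1 ha2]
    ring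
  rw [hcos] at h
  have hδm : 0 < δ ^ 2 * m2 := by positivity
  have e : (1 + (1 - δ ^ 2 * m2)) / (2 * (1 - (1 - δ ^ 2 * m2))) = 1 / (δ ^ 2 * m2) - 1 / 2 := by
    field_simp
    ring
  rw [e] at h
  exact h
end Free

end Summit.Ventures.LatticeQCDFlow.Exactness
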